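import Summits.BirchSwinnertonDyer.BirchSwinnertonDyer.Theorems.BiquadraticEisensteinDescentHeegnerTwistCouplingInSupplyDukeBilinearCorner
import Summits.BirchSwinnertonDyer.BirchSwinnertonDyer.Theorems.BiquadraticEisensteinDescentHeegnerTwistCouplingInSupplyResiduePin
import Mathlib.Analysis.SpecialFunctions.Pow.Asymptotics
import HarnessLib

set_option linter.dupNamespace false -- `Summit.BirchSwinnertonDyer.BirchSwinnertonDyer.Theorems.…` (summit = sub, D-0017)
set_option autoImplicit false

/-!
# Crux `HeegnerTwistCouplingInSupply` (stmt-BirchSwinnertonDyer-21381), card `class-number-switch-duke-bilinear` —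
# the card's `FirstLemma` VERBATIM SHAPE: from `DukeShrinkingDiscPin` (Case A, disc form) and `NonresidueTripleB` (Case B,
# `ℓ₁ℓ₃ℓ₅ ≤ 16p^{3/2+3ε}`) to `EpCornerAllLargeP`, the size thresholds discharged by `log p = o(p^θ)`

Route `BiquadraticEisensteinDescent` (cell `pub/bsd-wall`; width seat `bsd-wall-cm-bed-w4` g25; theorems only,
`--supports 21381`). Sequel of `…DukeBilinearCorner.lean` (pointwise cells + switch in size-effective form) and
`…ResiduePin.lean` (`DukeShrinkingDiscPin ⟹ ResiduePinA`).

* §5 `exists_nat_add_mul_log_lt_rpow` — `A + B·log p < p^θ` for all large `p` (`θ > 0`; Mathlib `isLittleO_log_rpow_atTop`);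
  ★ `exists_nat_size_lt` — for `c₀ > 0`, `κ < 2`: beyond some `N`, every `m ≤ c₀·p^κ` has `π⁻¹·√m·log m < p` (the
  class-number-formula majorant below the crux's threshold `p`); `sizeA_eventually` (`2pℓ₃`, `ℓ₃ ≤ p^{1−δ}`: `κ = 2 − δ`) and
  `sizeB_eventually` (`ℓ₁ℓ₃ℓ₅ ≤ 16p^{3/2+3ε}`, `ε < 1/6`: `κ = 3/2 + 3ε`).
* §6 ★ `firstLemma` — the card's `FirstLemma` with its two supplies in the card's own (rpow) currency and the class-number side
  condition `p^{1/2−η} ≤ h(−4p)` abstracted to an arbitrary predicate `C`: `DukeShrinkingDiscPin`-with-`C` (odd `a, b, x`,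
  `x² = 2p + a² + 2b²`, `a² + 2b² ≤ p^{1−δ}`, `δ > 0`) ∧ `NonresidueTripleB`-with-`¬C` (`ℓ₁ℓ₃ℓ₅ ≤ 16p^{3/2+3ε}`, `ε < 1/6`)
  ∧ the five named facts ⟹ `EpCornerAllLargeP` (the crux's conclusion on `E_p` for every prime `p ≡ 7 (mod 8)` beyond some
  `p₁`, `h(K′) < p`, no side condition on `p mod 3, 5`). The card's `ResidueCell` / `NonresidueCell` inputs are now tree
  theorems and no longer hypotheses; its `η` (and `3ε < η`) belongs to the supplies' own proofs and does not enter the glue.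

HONEST FRAMING: glue + elementary asymptotics only; the supplies (Duke 1988 / Iwaniec 1987 / Young 2017 shrinking disc;
Heath-Brown 1995 bilinear mean value + reduced-form lacunarity + PNT mod 8) are research / print inputs NOT proved here; the
five named facts are hypotheses; crux 21381 and BSD are NOT proved. No definition, no named fact, no `sorry`; axioms standard.
[cite: HeathBrown1994SelmerCongruentII, Appendix (Monsky), typescript p. 39 L10–L33] [cite: BurungaleTian2026, Thm. 1.1]
[cite: BurungaleFlach2024, Thm. 1.1 and Cor. 2] [cite: Oesterle1988Gauss, II §3 Proposition p. 57 (27)]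
-/

namespace Summit.BirchSwinnertonDyer.BirchSwinnertonDyer.Theorems.DukeBilinearCells

open Filter Asymptotics
open Literature.NumberTheory.EllipticCurves Literature.NumberTheory.EllipticCurves.HeathBrown1994

/-! ## §5 The size thresholds: `π⁻¹·√m·log m < p` for `m ≤ c₀ p^κ`, `κ < 2`, `p` large -/

/-- **`A + B·log p < p^θ` for all large natural `p`** (`θ > 0`): `log = o(x^θ)` at `+∞`. [folklore] -/
theorem exists_nat_add_mul_log_lt_rpow (A B θ : ℝ) (hθ : 0 < θ) :
    ∃ N : ℕ, ∀ p : ℕ, N ≤ p → A + B * Real.log p < (p : ℝ) ^ θ := by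
  set B' := max B 1 with hB'
  have hB'pos : 0 < B' := lt_of_lt_of_le one_pos (le_max_right _ _)
  have h1 : ∀ᶠ x : ℝ in atTop, ‖Real.log x‖ ≤ (1 / (2 * B')) * ‖x ^ θ‖ :=
    (isLittleO_log_rpow_atTop hθ).bound (by positivity)
  have h2 : ∀ᶠ x : ℝ in atTop, 2 * |A| + 1 ≤ x ^ θ := (tendsto_rpow_atTop hθ).eventually_ge_atTop _
  have h3 : ∀ᶠ x : ℝ in atTop, (1 : ℝ) ≤ x := eventually_ge_atTop 1
  obtain ⟨X, hX⟩ := eventually_atTop.mp (h1.and (h2.and h3))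
  refine ⟨⌈X⌉₊, fun p hp => ?_⟩
  have hpX : X ≤ (p : ℝ) := le_trans (Nat.le_ceil X) (by exact_mod_cast hp)
  obtain ⟨hlog, hbig, hp1⟩ := hX p hpX
  have hlog0 : 0 ≤ Real.log p := Real.log_nonneg hp1
  have hrpow0 : 0 ≤ (p : ℝ) ^ θ := Real.rpow_nonneg (by linarith) θ
  rw [Real.norm_eq_abs, Real.norm_eq_abs, abs_of_nonneg hlog0, abs_of_nonneg hrpow0] at hlog
  have hBlog : B * Real.log p ≤ B' * Real.log p := mul_le_mul_of_nonneg_right (le_max_left _ _) hlog0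
  have hB'log : B' * Real.log p ≤ (1 / 2) * (p : ℝ) ^ θ := by
    calc B' * Real.log p ≤ B' * ((1 / (2 * B')) * (p : ℝ) ^ θ) := mul_le_mul_of_nonneg_left hlog hB'pos.le
      _ = (1 / 2) * (p : ℝ) ^ θ := by field_simp
  have hA : A ≤ |A| := le_abs_self A
  linarith

/-- ★ **The class-number-formula majorant drops below `p`**: for `c₀ > 0` and `κ < 2` there is `N` such that for all natural
`p ≥ N` and every natural `m ≤ c₀·p^κ`: `π⁻¹·√m·log m < p` (`√(c₀p^κ)·log(c₀p^κ) = √c₀·p^{κ/2}·(log c₀ + κ log p)` and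
`log p = o(p^{1−κ/2})`). [cite: Oesterle1988Gauss, II §3 Proposition p. 57 (27)] -/
theorem exists_nat_size_lt (c₀ κ : ℝ) (hc₀ : 0 < c₀) (hκ : κ < 2) :
    ∃ N : ℕ, ∀ p m : ℕ, N ≤ p → (m : ℝ) ≤ c₀ * (p : ℝ) ^ κ →
      Real.pi⁻¹ * Real.sqrt (m : ℝ) * Real.log (m : ℝ) < p := by
  -- constants: `π⁻¹ √c₀ (log c₀ + κ log p) < p^{1 − κ/2}` for large `p`
  obtain ⟨N₀, hN₀⟩ := exists_nat_add_mul_log_lt_rpow (Real.pi⁻¹ * Real.sqrt c₀ * Real.log c₀)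
    (Real.pi⁻¹ * Real.sqrt c₀ * κ) (1 - κ / 2) (by linarith)
  refine ⟨max N₀ 1, fun p m hp hm => ?_⟩
  have hp1 : 1 ≤ p := le_trans (le_max_right _ _) hp
  have hpR : (1 : ℝ) ≤ (p : ℝ) := by exact_mod_cast hp1
  have hp0 : (0 : ℝ) < (p : ℝ) := by linarith
  have hπ : 0 < Real.pi⁻¹ := inv_pos.mpr Real.pi_pos
  have key := hN₀ p (le_trans (le_max_left _ _) hp)
  -- the right-hand side of `key`, times `p^{κ/2}`, is `p`
  have hsplit : (p : ℝ) ^ (1 - κ / 2) * (p : ℝ) ^ (κ / 2) = p := by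
    rw [← Real.rpow_add hp0]; norm_num
  rcases Nat.eq_zero_or_pos m with hm0 | hmpos
  · subst hm0
    simp only [Nat.cast_zero, Real.sqrt_zero, mul_zero, zero_mul]
    exact_mod_cast lt_of_lt_of_le one_pos hp1
  -- `m ≥ 1`: compare with `y = c₀ p^κ`
  set y : ℝ := c₀ * (p : ℝ) ^ κ with hy
  have hpk : 0 < (p : ℝ) ^ κ := Real.rpow_pos_of_pos hp0 κ
  have hy0 : 0 < y := mul_pos hc₀ hpk
  have hm1 : (1 : ℝ) ≤ (m : ℝ) := by exact_mod_cast hmpos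
  have hmono := sqrt_mul_log_mono hm1 hm
  have hsqrtp : Real.sqrt ((p : ℝ) ^ κ) = (p : ℝ) ^ (κ / 2) := by
    rw [Real.sqrt_eq_rpow, ← Real.rpow_mul hp0.le]
    congr 1
    ring
  have hsqrt : Real.sqrt y = Real.sqrt c₀ * (p : ℝ) ^ (κ / 2) := by
    rw [hy, Real.sqrt_mul hc₀.le, hsqrtp]
  have hlogy : Real.log y = Real.log c₀ + κ * Real.log p := by
    rw [hy, Real.log_mul hc₀.ne' hpk.ne', Real.log_rpow hp0]
  have hpk2 : 0 < (p : ℝ) ^ (κ / 2) := Real.rpow_pos_of_pos hp0 _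
  calc Real.pi⁻¹ * Real.sqrt (m : ℝ) * Real.log (m : ℝ)
      ≤ Real.pi⁻¹ * (Real.sqrt y * Real.log y) := by
        rw [mul_assoc]; exact mul_le_mul_of_nonneg_left hmono hπ.le
    _ = (Real.pi⁻¹ * Real.sqrt c₀ * Real.log c₀ + Real.pi⁻¹ * Real.sqrt c₀ * κ * Real.log p) *
          (p : ℝ) ^ (κ / 2) := by rw [hsqrt, hlogy]; ring
    _ < (p : ℝ) ^ (1 - κ / 2) * (p : ℝ) ^ (κ / 2) := mul_lt_mul_of_pos_right key hpk2
    _ = p := hsplit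

/-- **Size threshold of Case A**: for `δ > 0`, beyond some `N`, `ℓ ≤ p^{1−δ}` forces `π⁻¹·√(2pℓ)·log(2pℓ) < p`
(`2pℓ ≤ 2p^{2−δ}`, `κ = 2 − δ < 2`). [cite: Oesterle1988Gauss, II §3 Proposition p. 57 (27)] -/
theorem sizeA_eventually {δ : ℝ} (hδ : 0 < δ) :
    ∃ N : ℕ, ∀ p ℓ : ℕ, N ≤ p → (ℓ : ℝ) ≤ (p : ℝ) ^ (1 - δ) →
      Real.pi⁻¹ * Real.sqrt ((2 * p * ℓ : ℕ) : ℝ) * Real.log ((2 * p * ℓ : ℕ) : ℝ) < p := by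
  obtain ⟨N, hN⟩ := exists_nat_size_lt 2 (2 - δ) two_pos (by linarith)
  refine ⟨max N 1, fun p ℓ hp hℓ => hN p (2 * p * ℓ) (le_trans (le_max_left _ _) hp) ?_⟩
  have hp1 : 1 ≤ p := le_trans (le_max_right _ _) hp
  have hpos : (0 : ℝ) < (p : ℝ) := by exact_mod_cast hp1
  have hpp : (p : ℝ) * (p : ℝ) ^ (1 - δ) = (p : ℝ) ^ (2 - δ) := by
    rw [show (2 - δ) = 1 + (1 - δ) by ring, Real.rpow_add hpos, Real.rpow_one]
  push_cast
  calc (2 : ℝ) * p * ℓ ≤ 2 * p * (p : ℝ) ^ (1 - δ) :=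
        mul_le_mul_of_nonneg_left hℓ (by positivity)
    _ = 2 * (p : ℝ) ^ (2 - δ) := by rw [mul_assoc, hpp]

/-- **Size threshold of Case B**: for `ε < 1/6`, beyond some `N`, `ℓ₁ℓ₃ℓ₅ ≤ 16p^{3/2+3ε}` forces
`π⁻¹·√(ℓ₁ℓ₃ℓ₅)·log(ℓ₁ℓ₃ℓ₅) < p` (`κ = 3/2 + 3ε < 2`). [cite: Oesterle1988Gauss, II §3 Proposition p. 57 (27)] -/
theorem sizeB_eventually {ε : ℝ} (hε : ε < 1 / 6) :
    ∃ N : ℕ, ∀ p m : ℕ, N ≤ p → (m : ℝ) ≤ 16 * (p : ℝ) ^ (3 / 2 + 3 * ε) →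
      Real.pi⁻¹ * Real.sqrt (m : ℝ) * Real.log (m : ℝ) < p :=
  exists_nat_size_lt 16 (3 / 2 + 3 * ε) (by norm_num) (by linarith)

/-! ## §6 The card's `FirstLemma`, verbatim shape -/

/-- ★ **The card's `FirstLemma` (kernel form).** Let `C` be any predicate on primes (the card's switch `p^{1/2−η} ≤ h(−4p)`).
SUPPLY A (`DukeShrinkingDiscPin`, disc form): beyond `p₀`, every prime `p ≡ 7 (mod 8)` with `C p` has odd `a, b` and `x` with
`x² = 2p + a² + 2b²`, `a² + 2b² ≤ p^{1−δ}` (`δ > 0`). SUPPLY B (`NonresidueTripleB`): beyond `p₀′`, every prime `p ≡ 7 (mod 8)`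
with `¬ C p` has primes `ℓ₁ ≡ 1, ℓ₃ ≡ 3, ℓ₅ ≡ 5 (mod 8)` with `(ℓᵢ/p) = −1`, `(ℓ₁/ℓ₃) = +1`, `ℓ₁ℓ₃ℓ₅ ≤ 16p^{3/2+3ε}` (`ε < 1/6`).
Then, modulo Modularity, Monsky (odd), Burungale–Tian, Deuring–Hecke and Burungale–Flach (hypotheses by name), the card's
`EpCornerAllLargeP` holds: for every prime `p ≡ 7 (mod 8)` beyond some `p₁` there is an imaginary quadratic Heegner field `K′`
of `N(E_p)` with `|d_{K′}| > 4`, `L(E_p^{(d_{K′})}, 1) ≠ 0`, `h(K′) < p` and `p ∤ h(K′)` — the conclusion of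
`HeegnerTwistCouplingInSupply` on the whole `E_p` corner, no side condition on `p mod 3, 5`. (Chain: A ⟶ `(3,+)` pin
`residuePin_of_shrinkingDisc` ⟶ `sizeA_eventually` ⟶ `cruxConclusion_caseA`; B ⟶ `sizeB_eventually` ⟶ `cruxConclusion_caseB`;
switch `epCornerAllLargeP_of_supplies`.) [cite: HeathBrown1994SelmerCongruentII, Appendix (Monsky), typescript p. 39 L27–L33]
[cite: BurungaleTian2026, Thm. 1.1] [cite: BurungaleFlach2024, Thm. 1.1 and Cor. 2] [cite: Oesterle1988Gauss, II §3 Proposition p. 57 (27)] -/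
theorem firstLemma (hmod : ModularForms.exists_isNewformOf) (hM : monsky_card_selmerGroup_two_odd)
    (hBT : burungaleTian_analyticRank_eq_zero_of_selmerCorank_eq_zero_of_hasCM)
    (hH : hasEntireLFunction_of_j_mem_maximalCMJInvariants) (hBF : bsdTriple_of_hasCM_of_L_one_ne_zero)
    (C : ℕ → Prop) {δ ε : ℝ} (hδ : 0 < δ) (hε : ε < 1 / 6)
    (hDuke : ∃ p₀ : ℕ, ∀ p : ℕ, p.Prime → p₀ ≤ p → p % 8 = 7 → C p →
      ∃ x a b : ℕ, Odd a ∧ Odd b ∧ x ^ 2 = 2 * p + a ^ 2 + 2 * b ^ 2 ∧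
        ((a ^ 2 + 2 * b ^ 2 : ℕ) : ℝ) ≤ (p : ℝ) ^ (1 - δ))
    (hTriple : ∃ p₀ : ℕ, ∀ p : ℕ, p.Prime → p₀ ≤ p → p % 8 = 7 → ¬ C p →
      ∃ ℓ₁ ℓ₃ ℓ₅ : ℕ, ℓ₁.Prime ∧ ℓ₃.Prime ∧ ℓ₅.Prime ∧ ℓ₁ % 8 = 1 ∧ ℓ₃ % 8 = 3 ∧ ℓ₅ % 8 = 5 ∧
        jacobiSym (ℓ₁ : ℤ) p = -1 ∧ jacobiSym (ℓ₃ : ℤ) p = -1 ∧ jacobiSym (ℓ₅ : ℤ) p = -1 ∧ jacobiSym (ℓ₁ : ℤ) ℓ₃ = 1 ∧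
        ((ℓ₁ * ℓ₃ * ℓ₅ : ℕ) : ℝ) ≤ 16 * (p : ℝ) ^ (3 / 2 + 3 * ε)) :
    ∃ p₁ : ℕ, ∀ (p : ℕ) [Fact p.Prime] [(congruentNumberCurve p).IsElliptic]
      [(congruentNumberCurve p).IsGloballyMinimal] [NeZero ((congruentNumberCurve p).conductorNorm ℤ)],
      p₁ ≤ p → p % 8 = 7 →
      ∃ (K : Type) (_ : Field K) (_ : NumberField K),
        IsImaginaryQuadratic K ∧ 4 < (NumberField.discr K).natAbs ∧
        SatisfiesHeegnerHypothesis ((congruentNumberCurve p).conductorNorm ℤ) K ∧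
        ((congruentNumberCurve p).quadraticTwist (NumberField.discr K : ℚ)).entireLFunction 1 ≠ 0 ∧
        NumberField.classNumber K < p ∧ ¬ p ∣ NumberField.classNumber K := by
  -- Case A: disc ⟶ `(3,+)` pin (`residuePinA_of_dukeShrinkingDiscPin`) ⟶ size-effective form
  obtain ⟨pA, hA⟩ := residuePinA_of_dukeShrinkingDiscPin C δ hDuke
  obtain ⟨NA, hNA⟩ := sizeA_eventually hδ
  obtain ⟨pB, hB⟩ := hTriple
  obtain ⟨NB, hNB⟩ := sizeB_eventually hε
  refine epCornerAllLargeP_of_supplies hmod hM hBT hH hBF C (p₀ := max pA NA) (p₀' := max pB NB) ?_ ?_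
  · intro p hp hp₀ hp8 hC
    obtain ⟨ℓ₃, h₃, h38, h3p, hle⟩ := hA p hp (le_trans (le_max_left _ _) hp₀) hp8 hC
    exact ⟨ℓ₃, h₃, h38, h3p, hNA p ℓ₃ (le_trans (le_max_right _ _) hp₀) hle⟩
  · intro p hp hp₀ hp8 hC
    obtain ⟨ℓ₁, ℓ₃, ℓ₅, h₁, h₃, h₅, h18, h38, h58, h1p, h3p, h5p, h13, hle⟩ :=
      hB p hp (le_trans (le_max_left _ _) hp₀) hp8 hC
    exact ⟨ℓ₁, ℓ₃, ℓ₅, h₁, h₃, h₅, h18, h38, h58, h1p, h3p, h5p, h13,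
      hNB p (ℓ₁ * ℓ₃ * ℓ₅) (le_trans (le_max_right _ _) hp₀) hle⟩

end Summit.BirchSwinnertonDyer.BirchSwinnertonDyer.Theorems.DukeBilinearCells
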